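import Summits.QuantumFields.YangMills.Theorems.FluctuationComparisonRegPrIntLS2BetaQTubeOfAligned
import Summits.QuantumFields.YangMills.Theorems.FluctuationComparisonRegPrIntLS2BetaCombTransporterAxialT
import HarnessLib

/-!
# (Q-TUBE) FROM AN AXIALLY ALIGNED, BONDWISE-CLOSE PAIR — the `hax` edition of ✓`…S2BetaQTubeOfAligned` (print's aligner currency; depth-free constants)

Crux `stmt-QuantumFields-20520` (`…Theses.UnitScaleTilt.FluctuationComparisonRegPrIntL`), LINE g18-1 S2β, organ (C3) ∕ DET-REP (B), EDGE third, (Q-TUBE); cell `ym3-torus`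
(HUMAN RULING D-0037 — rung R3, not Clay), width seat `ym3-torus-px21` g17; count-neutral helper (`--kind proof --supports stmt-QuantumFields-20520 --as helper`).
Theorems only: 0 `def`, 0 `instance`, 0 `notation`, 0 `sorry`.
WHY.  ✓p790779 `…S2BetaQTubeOfAligned` (ymfull-r3-prover-4 g0) feeds the cover row (F6) of ✓`…TubularChartDockLocalWinId` from BONDWISE closeness under EXACT comb
alignment `hT : combTransporter (K−J) W = combTransporter (K−J) U₀`.  Print's aligner ✓`UnitScaleTiltProp7AxialGauge.exists_axialGauge_T3` (and the interior ∕ face sup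
bounds ✓`…AxialGaugeBlock.dist1_mul_inv_le_interior`, ✓`…AxialGaugeFace.dist1_mul_inv_le_face_T3`) deliver alignment in B5's TREE-CONTOUR currency
`hax : ∀ x, axialT W (rootOf k x) x = axialT U₀ (rootOf k x) x` instead, and `axialT ≠ combTransporter` (different staircases).  This file is FILE 9 with `hax` (+ the
plaquette radii `PlaqSmall δ_W W`, `PlaqSmall δ₀ U₀`) in place of `hT`, via this seat's ✓p790546 ★★★`…CombTransporterAxialT.dist1_combCoordRel_le_of_axialT_eq`: the (F6)
test quantity is within `dist1(W b U₀ b⁻¹) + (d(Lᵏ−1))²∕2·(δ_W+δ₀)` of `1` — so the thresholds are asked of `t + (d(Lᵏ−1))²∕2·(δ_W+δ₀)` (`= t + (d²∕2)(e_W+e₀)` at the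
regular radii `δ = e·L^{−2k}`; DEPTH-FREE).
WHAT.  ★★★ `slice_of_axialAligned_bondwiseClose`, ★★★ `qTube_of_axialAligned_gaugeAct`, ★★★ `cornerRows_text_of_axialAlignedClose` — FILE 9's three theorems, same
conclusions, `hT ↦ (hk, hδW, hδ₀, hW, hU₀, hax)`, `t ↦ t + 2·((d(Lᵏ−1))²∕4)·(δ_W+δ₀)` in `ht₁ ht₂ ht₃`.
HONEST SCOPE.  Group bookkeeping over landed letters; nothing of CLOSE-ALIGNED-MIN's assembly (aligner + interior + face + (β3) at the carrier) ∕ DET-REP (B) ∕ 20520 is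
proved here; rung R3 = SU(2) YM₃ on T³ — NOT d = 4, NOT infinite volume, NOT a mass gap, NOT Clay.
[cite: Balaban1985RegularSpaces, Lemma 1 (1.24)-(1.26) pp.79-80; Balaban1985Averaging, (8)-(9) pp.18-19, pp.24-25; Balaban1985Variational, Thm 1 (8)-(10) p.279]
-/

noncomputable section

open MeasureTheory Filter Topology Set Function Metric
open scoped Matrix.Norms.L2Operator
open Literature.MathematicalPhysics.QuantumFieldTheory.Balaban1983to89
open Literature.MathematicalPhysics.QuantumFieldTheory.Balaban1983to89.T3ContinuumYM3Torus
open Literature.MathematicalPhysics.QuantumFieldTheory.Balaban1983to89.HaarExponentialChart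
open Literature.MathematicalPhysics.QuantumFieldTheory.Balaban1983to89.LogChartProduct
open Literature.MathematicalPhysics.QuantumFieldTheory.Balaban1983to89.T3UnitLawDensityEML
open Literature.MathematicalPhysics.QuantumFieldTheory.Balaban1983to89.T3TiltDescent
open Literature.MathematicalPhysics.QuantumFieldTheory.Balaban1983to89.T3ConstrainedMinimiser (fibre)
open Literature.MathematicalPhysics.QuantumFieldTheory.Balaban1983to89.T4Continuum
open scoped Literature.MathematicalPhysics.QuantumFieldTheory.Balaban1983to89.T3OrbitAverage
open Summit.QuantumFields.YangMills.Theorems.FluctuationComparisonRegPrIntLWregChain (iterCentralBond iterCentralBond_injective)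
open Summit.QuantumFields.YangMills.Theorems.FluctuationComparisonRegPrIntLWregGlue (WindowChart)
open Summit.QuantumFields.YangMills.Theorems.FluctuationComparisonRegPrIntLS2BetaResidualSubgroup
open Summit.QuantumFields.YangMills.Theorems.FluctuationComparisonRegPrIntLS2BetaResidualGauge (gaugeAct_inv_gaugeAct)
open Summit.QuantumFields.YangMills.Theorems.FluctuationComparisonRegPrIntLS2BetaSignedComb (combTransporter)
open Summit.QuantumFields.YangMills.Theorems.FluctuationComparisonRegPrIntLS2BetaSignedCombKill (combSet)
open Summit.QuantumFields.YangMills.Theorems.FluctuationComparisonRegPrIntLS2BetaCornerInTube (cornerRows_text_of_pivotAct_eq)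
open Summit.QuantumFields.YangMills.Theorems.FluctuationComparisonRegPrIntLS2BetaSignedCombSupLipschitz (mem_window_half_of_dist1_le)

open Summit.QuantumFields.YangMills.Theorems.FluctuationComparisonRegPrIntLS2BetaCombTransporterAxialT (dist1_combCoordRel_le_of_axialT_eq)
open Literature.MathematicalPhysics.QuantumFieldTheory.Balaban1983to89.B10Eq27TorusAxialLog (axialT)
open Literature.MathematicalPhysics.QuantumFieldTheory.Balaban1983to89.T4RootedResidualGauge (rootOf)

namespace Summit.QuantumFields.YangMills.Theorems.FluctuationComparisonRegPrIntLS2BetaQTubeOfAxialAligned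

variable (F : T3Family) {J K : ℕ} (hJK : J ≤ K)

/-- ★★★ **ON THE SLICE FROM AXIALLY ALIGNED BONDWISE CLOSENESS — print's aligner currency, NO comb factor.**  `W` axially aligned to `U₀` (`hax`), plaquettes of `W`, `U₀`
within `δ_W`, `δ₀` of `1`, bondwise `dist1(W b U₀ b⁻¹) ≤ t` off comb ∪ pivots, and `t + (d(Lᵏ−1))²∕2·(δ_W+δ₀)` below the chart thresholds ⟹ `W` is on the slice:
`W = pivotAct ι (w, c ↦ W(ι c) U₀(ι c)⁻¹) (σ y)`, `y ∈ UV`.  (= ✓`slice_of_aligned_bondwiseClose` with `hT ↦ hax` via ✓`dist1_combCoordRel_le_of_axialT_eq`.)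
[cite: Balaban1985RegularSpaces, Lemma 1 (1.25) p.79; Balaban1985Averaging, pp.24-25; Helgason2000, Ch. I §1 Thm 1.14 p.96] -/
theorem slice_of_axialAligned_bondwiseClose (hk : K - J ≤ (F.P K).m + (F.P K).K)
    {dV : ℕ} {U₀ : GaugeField (F.P K) 0 (Matrix.specialUnitaryGroup (Fin 2) ℂ)}
    {σ : EuclideanSpace ℝ (Fin dV) → GaugeField (F.P K) 0 (Matrix.specialUnitaryGroup (Fin 2) ℂ)}
    {UV : Set (EuclideanSpace ℝ (Fin dV))}
    (hF6 : ∀ V' : GaugeField (F.P K) 0 (Matrix.specialUnitaryGroup (Fin 2) ℂ),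
        (∀ (b : PBond (F.P K) 0) (hb : b ∉ (combSet (K - J) : Set (PBond (F.P K) 0)) ∪ Set.range (iterCentralBond (P := F.P K) (K - J))),
          (combTransporter (K - J) U₀ b.src * U₀ b * (combTransporter (K - J) U₀ b.tgt)⁻¹)⁻¹ *
              (combTransporter (K - J) V' b.src * V' b * (combTransporter (K - J) V' b.tgt)⁻¹) ∈
            (isChartRep_specialUnitaryGroup (n := Fin 2)).window (IsChartRep.chartRadius (specialUnitaryLogChart (Fin 2)) / 2)) →
        ∃ y ∈ UV, ∃ w : residualSubgroup F hJK,
          (w : Site (F.P K) 0 → Matrix.specialUnitaryGroup (Fin 2) ℂ) = (fun x => (combTransporter (K - J) V' x)⁻¹ * combTransporter (K - J) U₀ x) ∧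
          V' = pivotAct F hJK (iterCentralBond (P := F.P K) (K - J))
            (w, fun c => V' (iterCentralBond (P := F.P K) (K - J) c) * (U₀ (iterCentralBond (P := F.P K) (K - J) c))⁻¹) (σ y))
    {W : GaugeField (F.P K) 0 (Matrix.specialUnitaryGroup (Fin 2) ℂ)} {δW δ₀ t : ℝ} (hδW : 0 ≤ δW) (hδ₀ : 0 ≤ δ₀)
    (hW : PlaqSmall δW W) (hU₀ : PlaqSmall δ₀ U₀)
    (hax : ∀ x : Site (F.P K) 0, axialT W (rootOf (K - J) x) x = axialT U₀ (rootOf (K - J) x) x)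
    (hclose : ∀ (b : PBond (F.P K) 0), b ∉ (combSet (K - J) : Set (PBond (F.P K) 0)) ∪ Set.range (iterCentralBond (P := F.P K) (K - J)) →
      dist1 (W b * (U₀ b)⁻¹) ≤ t)
    (ht₁ : t + 2 * ((((((F.P K).d * ((F.P K).L ^ (K - J) - 1) : ℕ) : ℝ)) ^ 2 / 4) * (δW + δ₀)) < IsChartRep.innerRadius (specialUnitaryLogChart (Fin 2)))
    (ht₂ : t + 2 * ((((((F.P K).d * ((F.P K).L ^ (K - J) - 1) : ℕ) : ℝ)) ^ 2 / 4) * (δW + δ₀)) ≤ 1 / 2)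
    (ht₃ : 2 * (t + 2 * ((((((F.P K).d * ((F.P K).L ^ (K - J) - 1) : ℕ) : ℝ)) ^ 2 / 4) * (δW + δ₀))) < IsChartRep.chartRadius (specialUnitaryLogChart (Fin 2)) / 2) :
    ∃ y ∈ UV, ∃ w : residualSubgroup F hJK,
      W = pivotAct F hJK (iterCentralBond (P := F.P K) (K - J))
        (w, fun c => W (iterCentralBond (P := F.P K) (K - J) c) * (U₀ (iterCentralBond (P := F.P K) (K - J) c))⁻¹) (σ y) := by
  obtain ⟨y, hy, w, -, hW'⟩ := hF6 W fun b hb => by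
    refine mem_window_half_of_dist1_le _ ?_ ht₁ ht₂ ht₃
    exact (dist1_combCoordRel_le_of_axialT_eq hk W U₀ hδW hδ₀ hW hU₀ hax b).trans (by linarith [hclose b hb])
  exact ⟨y, hy, w, hW'⟩

/-- ★★★ **(Q-TUBE) FROM CLOSE-AXIALLY-ALIGNED**: if a residual translate `w' • u` of a fine field `u` is axially aligned to the base `U₀` (print's `hax`), has plaquettes within
`δ_W` of `1` (`U₀` within `δ₀`), and is within `t` of `U₀` on every free bond, with `t + (d(Lᵏ−1))²∕2·(δ_W+δ₀)` below the fixed chart thresholds, then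
`∃ k, ∃ y, y ∈ UV ∧ pivotAct ι k (σ y) = u` — the (Q-TUBE) letter of ✓`…S2BetaCornerInTube`, DEPTH-FREE in its hypotheses.
[cite: Balaban1985RegularSpaces, Lemma 1 (1.25) p.79; Balaban1985Averaging, (8) p.19, pp.24-25] -/
theorem qTube_of_axialAligned_gaugeAct (hk : K - J ≤ (F.P K).m + (F.P K).K)
    {dV : ℕ} {U₀ : GaugeField (F.P K) 0 (Matrix.specialUnitaryGroup (Fin 2) ℂ)}
    {σ : EuclideanSpace ℝ (Fin dV) → GaugeField (F.P K) 0 (Matrix.specialUnitaryGroup (Fin 2) ℂ)}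
    {UV : Set (EuclideanSpace ℝ (Fin dV))}
    (hF6 : ∀ V' : GaugeField (F.P K) 0 (Matrix.specialUnitaryGroup (Fin 2) ℂ),
        (∀ (b : PBond (F.P K) 0) (hb : b ∉ (combSet (K - J) : Set (PBond (F.P K) 0)) ∪ Set.range (iterCentralBond (P := F.P K) (K - J))),
          (combTransporter (K - J) U₀ b.src * U₀ b * (combTransporter (K - J) U₀ b.tgt)⁻¹)⁻¹ *
              (combTransporter (K - J) V' b.src * V' b * (combTransporter (K - J) V' b.tgt)⁻¹) ∈
            (isChartRep_specialUnitaryGroup (n := Fin 2)).window (IsChartRep.chartRadius (specialUnitaryLogChart (Fin 2)) / 2)) →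
        ∃ y ∈ UV, ∃ w : residualSubgroup F hJK,
          (w : Site (F.P K) 0 → Matrix.specialUnitaryGroup (Fin 2) ℂ) = (fun x => (combTransporter (K - J) V' x)⁻¹ * combTransporter (K - J) U₀ x) ∧
          V' = pivotAct F hJK (iterCentralBond (P := F.P K) (K - J))
            (w, fun c => V' (iterCentralBond (P := F.P K) (K - J) c) * (U₀ (iterCentralBond (P := F.P K) (K - J) c))⁻¹) (σ y))
    {u : GaugeField (F.P K) 0 (Matrix.specialUnitaryGroup (Fin 2) ℂ)} (w' : residualSubgroup F hJK) {δW δ₀ t : ℝ} (hδW : 0 ≤ δW) (hδ₀ : 0 ≤ δ₀)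
    (hW : PlaqSmall δW (GaugeField.gaugeAct (w' : Site (F.P K) 0 → Matrix.specialUnitaryGroup (Fin 2) ℂ) u)) (hU₀ : PlaqSmall δ₀ U₀)
    (hax : ∀ x : Site (F.P K) 0, axialT (GaugeField.gaugeAct (w' : Site (F.P K) 0 → Matrix.specialUnitaryGroup (Fin 2) ℂ) u) (rootOf (K - J) x) x =
      axialT U₀ (rootOf (K - J) x) x)
    (hclose : ∀ (b : PBond (F.P K) 0), b ∉ (combSet (K - J) : Set (PBond (F.P K) 0)) ∪ Set.range (iterCentralBond (P := F.P K) (K - J)) →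
      dist1 (GaugeField.gaugeAct (w' : Site (F.P K) 0 → Matrix.specialUnitaryGroup (Fin 2) ℂ) u b * (U₀ b)⁻¹) ≤ t)
    (ht₁ : t + 2 * ((((((F.P K).d * ((F.P K).L ^ (K - J) - 1) : ℕ) : ℝ)) ^ 2 / 4) * (δW + δ₀)) < IsChartRep.innerRadius (specialUnitaryLogChart (Fin 2)))
    (ht₂ : t + 2 * ((((((F.P K).d * ((F.P K).L ^ (K - J) - 1) : ℕ) : ℝ)) ^ 2 / 4) * (δW + δ₀)) ≤ 1 / 2)
    (ht₃ : 2 * (t + 2 * ((((((F.P K).d * ((F.P K).L ^ (K - J) - 1) : ℕ) : ℝ)) ^ 2 / 4) * (δW + δ₀))) < IsChartRep.chartRadius (specialUnitaryLogChart (Fin 2)) / 2) :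
    ∃ (k : ↥(residualSubgroup F hJK) × (PBond (F.P K) (K - J) → Matrix.specialUnitaryGroup (Fin 2) ℂ)) (y : EuclideanSpace ℝ (Fin dV)),
      y ∈ UV ∧ pivotAct F hJK (iterCentralBond (P := F.P K) (K - J)) k (σ y) = u := by
  set W : GaugeField (F.P K) 0 (Matrix.specialUnitaryGroup (Fin 2) ℂ) :=
    GaugeField.gaugeAct (w' : Site (F.P K) 0 → Matrix.specialUnitaryGroup (Fin 2) ℂ) u with hWdef
  obtain ⟨y, hy, w, hW'⟩ := slice_of_axialAligned_bondwiseClose F hJK hk hF6 (W := W) hδW hδ₀ hW hU₀ hax hclose ht₁ ht₂ ht₃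
  refine ⟨(w'⁻¹, fun c => u (iterCentralBond (P := F.P K) (K - J) c) * (W (iterCentralBond (P := F.P K) (K - J) c))⁻¹) *
      (w, fun c => W (iterCentralBond (P := F.P K) (K - J) c) * (U₀ (iterCentralBond (P := F.P K) (K - J) c))⁻¹), y, hy, ?_⟩
  rw [pivotAct_mul F hJK _ (iterCentralBond_injective (P := F.P K) hk), ← hW']
  funext b
  by_cases hb : ∃ c, iterCentralBond (P := F.P K) (K - J) c = b
  · obtain ⟨c, rfl⟩ := hb
    rw [pivotAct_apply_pivot F hJK _ (iterCentralBond_injective (P := F.P K) hk)]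
    show u _ * (W _)⁻¹ * W _ = u _
    rw [inv_mul_cancel_right]
  · rw [pivotAct_apply_of_not_mem_range F hJK _ _ _ hb]
    show GaugeField.gaugeAct (((w'⁻¹ : residualSubgroup F hJK)) : Site (F.P K) 0 → Matrix.specialUnitaryGroup (Fin 2) ℂ) W b = u b
    rw [Subgroup.coe_inv, hWdef, gaugeAct_inv_gaugeAct]

/-- ★★★ **THE CORNER ROWS FROM CLOSE-AXIALLY-ALIGNED-MIN** (the `hax` edition of ✓`…S2BetaQTubeOfAligned.cornerRows_text_of_alignedClose`): = ★★★`qTube_of_axialAligned_gaugeAct` then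
✓`cornerRows_text_of_pivotAct_eq`. [cite: Balaban1985Variational, Thm 1 (8)-(10) p.279; Balaban1985RegularSpaces, Lemma 1 (1.25) p.79; Balaban1985Averaging, §E Prop 6 p.26-27] -/
theorem cornerRows_text_of_axialAlignedClose (hk : K - J ≤ (F.P K).m + (F.P K).K)
    {Sf : Set (GaugeField (F.P K) 0 (Matrix.specialUnitaryGroup (Fin 2) ℂ))} {O : Set (GaugeField (F.P J) 0 (Matrix.specialUnitaryGroup (Fin 2) ℂ))}
    (c : WindowChart F hJK Sf O) (m : GaugeField (F.P J) 0 (Matrix.specialUnitaryGroup (Fin 2) ℂ) → ℝ)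
    {X : GaugeField (F.P J) 0 (Matrix.specialUnitaryGroup (Fin 2) ℂ)} {u : GaugeField (F.P K) 0 (Matrix.specialUnitaryGroup (Fin 2) ℂ)}
    (hu : u ∈ fibre F ℰp J K hJK X ∧ u ∈ Sf ∧ wilsonAction4 u = m X)
    (hcarr : ∀ k z, z ∈ {z : GaugeField (F.P K) 0 (Matrix.specialUnitaryGroup (Fin 2) ℂ) | c.jac (X, z) ≠ 0} →
      pivotAct F hJK (iterCentralBond (P := F.P K) (K - J)) k z ∈ {z : GaugeField (F.P K) 0 (Matrix.specialUnitaryGroup (Fin 2) ℂ) | c.jac (X, z) ≠ 0})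
    (hAinv : ∀ k, ∀ z ∈ {z : GaugeField (F.P K) 0 (Matrix.specialUnitaryGroup (Fin 2) ℂ) | c.jac (X, z) ≠ 0},
      wilsonAction4 (c.Φ (X, pivotAct F hJK (iterCentralBond (P := F.P K) (K - J)) k z)) = wilsonAction4 (c.Φ (X, z)))
    (hSinv : ∀ k, ∀ z ∈ {z : GaugeField (F.P K) 0 (Matrix.specialUnitaryGroup (Fin 2) ℂ) | c.jac (X, z) ≠ 0},
      c.Φ (X, z) ∈ Sf → c.Φ (X, pivotAct F hJK (iterCentralBond (P := F.P K) (K - J)) k z) ∈ Sf)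
    (hrec : ∀ U, descendTo F ℰp J K hJK U = X → U ∈ Sf → (c.jac (X, U) ≠ 0 ∧ c.Φ (X, U) = U) ∧
      {z : GaugeField (F.P K) 0 (Matrix.specialUnitaryGroup (Fin 2) ℂ) | c.jac (X, z) ≠ 0} ∈ 𝓝 U)
    {dV : ℕ} {U₀ : GaugeField (F.P K) 0 (Matrix.specialUnitaryGroup (Fin 2) ℂ)}
    {σ : EuclideanSpace ℝ (Fin dV) → GaugeField (F.P K) 0 (Matrix.specialUnitaryGroup (Fin 2) ℂ)} (hσ : Continuous σ)
    {UV : Set (EuclideanSpace ℝ (Fin dV))} {jV : EuclideanSpace ℝ (Fin dV) → ℝ} (hjV : ∀ y ∈ UV, 0 < jV y)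
    (hF6 : ∀ V' : GaugeField (F.P K) 0 (Matrix.specialUnitaryGroup (Fin 2) ℂ),
        (∀ (b : PBond (F.P K) 0) (hb : b ∉ (combSet (K - J) : Set (PBond (F.P K) 0)) ∪ Set.range (iterCentralBond (P := F.P K) (K - J))),
          (combTransporter (K - J) U₀ b.src * U₀ b * (combTransporter (K - J) U₀ b.tgt)⁻¹)⁻¹ *
              (combTransporter (K - J) V' b.src * V' b * (combTransporter (K - J) V' b.tgt)⁻¹) ∈
            (isChartRep_specialUnitaryGroup (n := Fin 2)).window (IsChartRep.chartRadius (specialUnitaryLogChart (Fin 2)) / 2)) →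
        ∃ y ∈ UV, ∃ w : residualSubgroup F hJK,
          (w : Site (F.P K) 0 → Matrix.specialUnitaryGroup (Fin 2) ℂ) = (fun x => (combTransporter (K - J) V' x)⁻¹ * combTransporter (K - J) U₀ x) ∧
          V' = pivotAct F hJK (iterCentralBond (P := F.P K) (K - J))
            (w, fun c => V' (iterCentralBond (P := F.P K) (K - J) c) * (U₀ (iterCentralBond (P := F.P K) (K - J) c))⁻¹) (σ y))
    (w' : residualSubgroup F hJK) {δW δ₀ t : ℝ} (hδW : 0 ≤ δW) (hδ₀ : 0 ≤ δ₀)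
    (hW : PlaqSmall δW (GaugeField.gaugeAct (w' : Site (F.P K) 0 → Matrix.specialUnitaryGroup (Fin 2) ℂ) u)) (hU₀ : PlaqSmall δ₀ U₀)
    (hax : ∀ x : Site (F.P K) 0, axialT (GaugeField.gaugeAct (w' : Site (F.P K) 0 → Matrix.specialUnitaryGroup (Fin 2) ℂ) u) (rootOf (K - J) x) x =
      axialT U₀ (rootOf (K - J) x) x)
    (hclose : ∀ (b : PBond (F.P K) 0), b ∉ (combSet (K - J) : Set (PBond (F.P K) 0)) ∪ Set.range (iterCentralBond (P := F.P K) (K - J)) →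
      dist1 (GaugeField.gaugeAct (w' : Site (F.P K) 0 → Matrix.specialUnitaryGroup (Fin 2) ℂ) u b * (U₀ b)⁻¹) ≤ t)
    (ht₁ : t + 2 * ((((((F.P K).d * ((F.P K).L ^ (K - J) - 1) : ℕ) : ℝ)) ^ 2 / 4) * (δW + δ₀)) < IsChartRep.innerRadius (specialUnitaryLogChart (Fin 2)))
    (ht₂ : t + 2 * ((((((F.P K).d * ((F.P K).L ^ (K - J) - 1) : ℕ) : ℝ)) ^ 2 / 4) * (δW + δ₀)) ≤ 1 / 2)
    (ht₃ : 2 * (t + 2 * ((((((F.P K).d * ((F.P K).L ^ (K - J) - 1) : ℕ) : ℝ)) ^ 2 / 4) * (δW + δ₀))) < IsChartRep.chartRadius (specialUnitaryLogChart (Fin 2)) / 2) :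
    ∃ y : EuclideanSpace ℝ (Fin dV),
      y ∈ UV ∧ 0 < jV y ∧ (∀ᶠ v in 𝓝 y, c.jac (X, σ v) ≠ 0) ∧ c.Φ (X, σ y) ∈ Sf ∧ wilsonAction4 (c.Φ (X, σ y)) = m X := by
  obtain ⟨k, y, hy, hΘ⟩ := qTube_of_axialAligned_gaugeAct F hJK hk hF6 w' hδW hδ₀ hW hU₀ hax hclose ht₁ ht₂ ht₃
  exact ⟨y, cornerRows_text_of_pivotAct_eq F hJK hk c m hu hcarr hAinv hSinv hrec hσ hΘ hy (hjV y hy)⟩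

end Summit.QuantumFields.YangMills.Theorems.FluctuationComparisonRegPrIntLS2BetaQTubeOfAxialAligned

end
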